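import Literature.AnabelianGeometry.AbsoluteAnabelian.NumberFieldValuationProSetArchProofs
import Literature.NumberTheory.GaloisRepresentations.AbsGaloisInvolutionsUnique
import Literature.FieldTheory.RealClosed.ArtinSchreierFiniteIndex
import HarnessLib

/-!
# The archimedean local elements of `V⊚(F̄/F)` seen from `G_F`: involutions ↔ decomposition groups

S. Mochizuki, *Topics in absolute anabelian geometry III* [MochizukiAbsTopIII2015], Def 5.1 (i)/(iii) pp. 113–115 (the
archimedean local elements of `V⊚(F̄/F)` and their decomposition groups `Π_v ⊆ Π`, "constructed from `Π`").

For the GENUINE valuation pro-set `NumberField.valuationProSet F` (abc-iut-L4-d2 p432664) THIS PROOF-ONLY FILE (0 definitions)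
records the group-theoretic DICTIONARY for archimedean local elements, assembled BY NAME from abc-iut-w5-d214's
Artin–Schreier files (`AbsGaloisInvolutions.lean` p435119: existence; `AbsGaloisInvolutionsUnique.lean` p436684: uniqueness):

* `existsUnique_arch_mem_decomp_of_sq_eq_one` — **every involution `τ ≠ 1` of `G_F` lies in the decomposition group of
  EXACTLY ONE archimedean local element of `V⊚(F̄/F)`**;
* `arch_eq_of_mem_decomp` — an archimedean local element is determined by any non-trivial element of its decomposition
  group (decomposition groups of distinct archimedean local elements meet trivially);
* `decomp_arch_injective_of_ne_bot` — hence `w ↦ Π_w` is injective on the archimedean local elements with non-trivial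
  decomposition group (those above REAL places of `F`).

So the archimedean local elements above real places, with their decomposition groups, are recovered from the topological
group `G_F` alone as «the subgroups `{1, τ}`, `τ` an involution» — the archimedean instance, at genuine data, of
"`V(Π)` constructed from `Π`".  Classical (Artin–Schreier); nothing here bears on [IUTchIII] Cor. 3.12 or takes a side.
-/

noncomputable section

open NumberField NumberField.InfinitePlace
open Literature.NumberTheory.GaloisRepresentations

namespace Literature.AnabelianGeometry.AbsoluteAnabelian.NumberFieldValuationProSet

open Field

variable (F : Type) [Field F]

/-- Membership in an archimedean decomposition group, in Mathlib's stabiliser vocabulary.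
[cite: MochizukiAbsTopIII2015, Def 5.1 (iii) p.115] -/
theorem mem_decomp_arch_iff (τ : absoluteGaloisGroup F) (w : Arch F) :
    τ ∈ (NumberField.valuationProSet F).decomp (Sum.inr (Sum.inr w)) ↔
      absoluteGaloisGroup.toAlgEquiv F τ ∈
        MulAction.stabilizer (AlgebraicClosure F ≃ₐ[F] AlgebraicClosure F) w := by
  rw [mem_decomp_inr_inr_iff, MulAction.mem_stabilizer_iff]
  exact Iff.rfl

/-- **Every involution of `G_F` lies in the decomposition group of exactly one archimedean local element of `V⊚(F̄/F)`.**
(Existence: Artin–Schreier, p435119; uniqueness: p436684.) [cite: ArtinSchreier1927Kennzeichnung, Satz 4 (direct corollary)] -/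
theorem existsUnique_arch_mem_decomp_of_sq_eq_one [NumberField F] (τ : absoluteGaloisGroup F) (h1 : τ ≠ 1) (h2 : τ ^ 2 = 1) :
    ∃! w : Arch F, τ ∈ (NumberField.valuationProSet F).decomp (Sum.inr (Sum.inr w)) := by
  haveI : Algebra.IsAlgebraic ℚ F := Algebra.IsAlgebraic.of_finite ℚ F
  obtain ⟨w, hw, huniq⟩ := existsUnique_infinitePlace_mem_stabilizer_of_sq_eq_one (K := F) τ h1 h2
  exact ⟨w, (mem_decomp_arch_iff F τ w).mpr hw, fun w' hw' => huniq w' ((mem_decomp_arch_iff F τ w').mp hw')⟩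

/-- An archimedean local element is determined by any NON-TRIVIAL element of its decomposition group: decomposition groups
of distinct archimedean local elements of `V⊚(F̄/F)` intersect trivially.
[cite: ArtinSchreier1927Kennzeichnung, Satz 4 (direct corollary)] -/
theorem arch_eq_of_mem_decomp [NumberField F] {τ : absoluteGaloisGroup F} (h1 : τ ≠ 1) {w w' : Arch F}
    (hw : τ ∈ (NumberField.valuationProSet F).decomp (Sum.inr (Sum.inr w)))
    (hw' : τ ∈ (NumberField.valuationProSet F).decomp (Sum.inr (Sum.inr w'))) : w = w' := by
  -- an element of an archimedean decomposition group is `1` or the (involutive) conjugation of the embedding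
  have h2 : τ ^ 2 = 1 := by
    have hw1 := (mem_decomp_arch_iff F τ w).mp hw
    rw [← InfinitePlace.mk_embedding w, InfinitePlace.mem_stabilizer_mk_iff] at hw1
    rcases hw1 with h | h
    · exact absurd ((MulEquiv.map_eq_one_iff _).mp h) h1
    · -- `IsConj φ c` and `IsConj φ c⁻¹` force `c = c⁻¹`
      have hinv : absoluteGaloisGroup.toAlgEquiv F τ = (absoluteGaloisGroup.toAlgEquiv F τ)⁻¹ := h.ext h.symm
      have hmul : absoluteGaloisGroup.toAlgEquiv F τ * absoluteGaloisGroup.toAlgEquiv F τ = 1 := by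
        calc absoluteGaloisGroup.toAlgEquiv F τ * absoluteGaloisGroup.toAlgEquiv F τ
            = absoluteGaloisGroup.toAlgEquiv F τ * (absoluteGaloisGroup.toAlgEquiv F τ)⁻¹ := by rw [← hinv]
          _ = 1 := mul_inv_cancel _
      apply (absoluteGaloisGroup.toAlgEquiv F).injective
      rw [map_pow, map_one, pow_two]
      exact hmul
  obtain ⟨w₀, _, huniq⟩ := existsUnique_arch_mem_decomp_of_sq_eq_one F τ h1 h2
  exact (huniq w hw).trans (huniq w' hw').symm

/-- `w ↦ Π_w` is injective on the archimedean local elements with non-trivial decomposition group (those above real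
places of `F`). [cite: ArtinSchreier1927Kennzeichnung, Satz 4 (direct corollary)] -/
theorem decomp_arch_injective_of_ne_bot [NumberField F] {w w' : Arch F}
    (hne : (NumberField.valuationProSet F).decomp (Sum.inr (Sum.inr w)) ≠ ⊥)
    (heq : (NumberField.valuationProSet F).decomp (Sum.inr (Sum.inr w)) =
      (NumberField.valuationProSet F).decomp (Sum.inr (Sum.inr w'))) : w = w' := by
  obtain ⟨τ, hτ, h1⟩ : ∃ τ, τ ∈ (NumberField.valuationProSet F).decomp (Sum.inr (Sum.inr w)) ∧ τ ≠ 1 := by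
    by_contra h
    push Not at h
    exact hne ((Subgroup.eq_bot_iff_forall _).mpr fun τ hτ => h τ hτ)
  exact arch_eq_of_mem_decomp F h1 hτ (heq ▸ hτ)

/-! ### v2: from involutions to ALL torsion ([NSW] (12.1.7), abc-iut-w5-d116's Artin–Schreier finite-index theorem) -/

/-- **Every non-trivial TORSION element of `G_F` lies in the decomposition group of exactly one archimedean local element of
`V⊚(F̄/F)`** — torsion of `G_F` is `2`-torsion (Artin–Schreier finite-index theorem, abc-iut-w5-d116
`absoluteGaloisGroup_orderOf_eq_two_of_isOfFinOrder`, BY NAME) and involutions are handled by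
`existsUnique_arch_mem_decomp_of_sq_eq_one`.  So the non-trivial finite subgroups of `G_F` are EXACTLY the decomposition
groups `{1, c_w}` of the archimedean local elements above real places ([NSW] (12.1.7)/(12.1.8) at genuine data).
[cite: ArtinSchreier1927Kennzeichnung, Satz 4 (corollary for Galois groups)] -/
theorem existsUnique_arch_mem_decomp_of_isOfFinOrder [NumberField F] (τ : absoluteGaloisGroup F)
    (hfin : IsOfFinOrder τ) (h1 : τ ≠ 1) :
    ∃! w : Arch F, τ ∈ (NumberField.valuationProSet F).decomp (Sum.inr (Sum.inr w)) := by
  haveI : Algebra.IsAlgebraic ℚ F := Algebra.IsAlgebraic.of_finite ℚ F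
  have h2 : orderOf τ = 2 :=
    Literature.FieldTheory.RealClosed.absoluteGaloisGroup_orderOf_eq_two_of_isOfFinOrder F τ hfin h1
  exact existsUnique_arch_mem_decomp_of_sq_eq_one F τ h1 (by rw [← h2, pow_orderOf_eq_one])

end Literature.AnabelianGeometry.AbsoluteAnabelian.NumberFieldValuationProSet

end
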